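/-
Origin: expansion seat `prover-pub-hodgecm-mc-binder-1-g12-0`, handover #61 2026-08-20T11:48:20Z md5 5530b3efc96e (NEW additive KERNEL leaf; imports HypCensus/IsoTwist only; drop-alone) (`HOME/mc/pub-hodgecm-mc-binder-1-g12/stage50/HodgeCM/Model/Binders/Real34IsoScaleSqrt.lean`, md5 5530b3efc96e, 68 lines);
landed by the second packager p2 gen 7 (p2-g7) in gate run 50 as `HodgeCM/Model/Binders/Real34IsoScaleSqrt.lean` (verbatim).
-/
/-
Origin: pub-hodgecm MODEL-CONSTRUCTION sub-cell (Hodge conjecture, CM-per-L package), seat mc-binder-1 gen 12, session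
prover-pub-hodgecm-mc-binder-1-g12-0, 2026-08-20.  Target in PKG: HodgeCM/Model/Binders/Real34IsoScaleSqrt.lean (NEW additive leaf; imports binder-2's installed
#52 `HypCensus/IsoTwist` only).  KERNEL MATHEMATICS ONLY.  Consumer: `harch` of the row-17 socket, HARCH-PLAN.md §5 (2): the frame scalings after the monomial
substitution `isoMat` (#59 `monoScale`) are the scalings of the pin `diag(b'₀, b'₁)`.
-/
import Summits.HodgeConjecture.HodgeCM.Model.HypCensus.IsoTwist_2

/-!
# Row 17 (`real34`): the square-root scaling identity behind `monoScale … = pairScale …` (HARCH-PLAN §5 (2))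

For binder-2's monomial isometry data (`HypCensus/IsoTwist`: `σ = isoPerm x x'`, `isoScale x x' i = √(x'ᵢ / x_{σ i})`, ratios positive):

* **`sqrt_abs_div_mul_isoScale`**: `√|x_{σ i} / c| · isoScale x x' i = √|x'ᵢ / c|` for every real `c` — the scaled-frame weight `√|x_{σ i}/c|` of the
  W-coordinate `σ i` (the tree's `sqrtAbs ∘ placeSignVec`, `c` the place scalar `c_W(v)`) times the substitution scale IS the weight of the `W′`-coordinate `i`;
* `sqrt_abs_mul_isoScale` (the `c`-free form) and `abs_mul_isoScale_sq`.

This is the only piece of real analysis in the comparison of `monoScale π s (pairScale 3 2 cmDV cmDW)` (#59) with `pairScale 3 2 cmDV cmDW′` (HARCH-PLAN §5).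

## References
* [Folland1989] G. B. Folland, *Harmonic Analysis in Phase Space*, Princeton UP (1989), §4.2 (substitution operators of the Siegel–Levi factor).
-/

set_option autoImplicit false

noncomputable section

namespace HodgeCM.Model.HypCensus

variable {x x' : Fin 2 → ℝ}

/-- Sign transfer: if `x'ᵢ / x_{σ i} > 0` then `|x_{σ i}| · (x'ᵢ / x_{σ i}) = |x'ᵢ|`. [folklore] -/
theorem abs_mul_isoScale_sq (hr : ∀ i, 0 < x' i / x (isoPerm x x' i)) (i : Fin 2) :
    |x (isoPerm x x' i)| * (x' i / x (isoPerm x x' i)) = |x' i| := by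
  have hx : x (isoPerm x x' i) ≠ 0 := by
    intro h
    have := hr i
    rw [h, div_zero] at this
    exact lt_irrefl _ this
  rcases lt_or_gt_of_ne hx with hneg | hpos
  · have hx' : x' i < 0 := by
      have h := hr i
      rw [div_pos_iff] at h
      rcases h with ⟨_, h2⟩ | ⟨h1, _⟩
      · exact absurd h2 (not_lt.2 hneg.le)
      · exact h1
    rw [abs_of_neg hneg, abs_of_neg hx']
    field_simp
  · have hx' : 0 < x' i := by
      have h := hr i
      rwa [div_pos_iff_of_pos_right hpos] at h
    rw [abs_of_pos hpos, abs_of_pos hx']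
    field_simp

/-- **`√|x_{σ i}| · isoScale x x' i = √|x'ᵢ|`.** [folklore] -/
theorem sqrt_abs_mul_isoScale (hr : ∀ i, 0 < x' i / x (isoPerm x x' i)) (i : Fin 2) :
    Real.sqrt |x (isoPerm x x' i)| * isoScale x x' i = Real.sqrt |x' i| := by
  rw [isoScale, ← Real.sqrt_mul (abs_nonneg _), abs_mul_isoScale_sq hr]

/-- **`√|x_{σ i} / c| · isoScale x x' i = √|x'ᵢ / c|`** for every real `c` (the place scalar of the scaled frame). [folklore] -/
theorem sqrt_abs_div_mul_isoScale (hr : ∀ i, 0 < x' i / x (isoPerm x x' i)) (c : ℝ) (i : Fin 2) :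
    Real.sqrt |x (isoPerm x x' i) / c| * isoScale x x' i = Real.sqrt |x' i / c| := by
  rw [abs_div, abs_div, Real.sqrt_div' _ , Real.sqrt_div' _, div_mul_eq_mul_div, sqrt_abs_mul_isoScale hr]
  all_goals exact abs_nonneg _

end HodgeCM.Model.HypCensus

end
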